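import Mathlib.LinearAlgebra.Eigenspace.Semisimple
import Mathlib.LinearAlgebra.Eigenspace.Zero
import Mathlib.LinearAlgebra.Eigenspace.Charpoly
import Mathlib.Algebra.DirectSum.LinearMap
import Mathlib.FieldTheory.Separable
import HarnessLib

/-!
# Traces of powers of a finite-order endomorphism are determined by its characteristic polynomial

Topic `Literature/RepresentationTheory/FiniteGroups`. Everything in this file is PROVED (no
`sorry`, no named facts).

For an endomorphism `f` of a finite-dimensional vector space `V` over an algebraically closed
field `K`:

* `Literature.RepresentationTheory.FiniteGroups.TracePow.trace_pow_eq_sum_rootMultiplicity` — if `f` is semisimple then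
  `tr(f ^ m) = Σ_μ mult_μ(χ_f) · μ ^ m` for every `m`, the sum over the roots `μ` of the
  characteristic polynomial `χ_f` (`f` is diagonalisable, `V = ⊕_μ V_μ` with
  `dim V_μ = mult_μ(χ_f)`; Mathlib `Module.End.IsSemisimple.iSup_eigenspace_eq_top`,
  `LinearMap.finrank_maxGenEigenspace_eq`, `LinearMap.trace_eq_sum_trace_restrict'`);
* `Literature.RepresentationTheory.FiniteGroups.TracePow.isSemisimple_of_pow_eq_one` — `f ^ N = 1` with `N ≠ 0` in `K` implies `f`
  semisimple (`X ^ N - 1` is separable; Mathlib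
  `Module.End.isSemisimple_of_squarefree_aeval_eq_zero`);
* `Literature.RepresentationTheory.FiniteGroups.TracePow.trace_pow_eq_of_charpoly_eq` — consequently, if `f ^ N = 1 = g ^ N` and
  `χ_f = χ_g` then `tr(f ^ m) = tr(g ^ m)` for all `m`;
  `Literature.RepresentationTheory.FiniteGroups.TracePow.matrix_trace_pow_eq_of_charpoly_eq` — the same for square matrices.

This is the linear-algebra input which lets equality of characteristic polynomials of Frobenius
at *some generator* of each cyclic subgroup replace equality of traces at *every* element in
Deligne–Serre's Lemme 3.2 (`Literature.NumberTheory.GaloisRepresentations.ArtinRepFrobeniusProofs`):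
for `q` of finite order and `k` prime to it, `χ(ρ(q^k)) = χ(ρ'(q^k))` gives
`tr ρ(q) = tr ρ((q^k)^{k'}) = tr ρ'(q)` with `k k' ≡ 1`.

## References

* N. Bourbaki, *Algèbre*, Ch. VII §5 (semisimple endomorphisms; diagonalisable endomorphisms and
  their characteristic polynomials). [folklore]
* C. W. Curtis, I. Reiner, *Representation Theory of Finite Groups and Associative Algebras*
  (1962), §30 (characters and characteristic roots). [folklore]
-/

noncomputable section

open Module Module.End Polynomial

namespace Literature.RepresentationTheory.FiniteGroups

namespace TracePow

variable {K V : Type*} [Field K] [AddCommGroup V] [Module K V]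

/-- On the `μ`-eigenspace of `f`, `f ^ m` acts as the scalar `μ ^ m`. [folklore] -/
theorem pow_apply_of_mem_eigenspace (f : End K V) (μ : K) (m : ℕ) {v : V}
    (hv : v ∈ f.eigenspace μ) : (f ^ m) v = μ ^ m • v := by
  induction m with
  | zero => simp
  | succ m ih =>
    rw [mem_eigenspace_iff] at hv
    rw [pow_succ, Module.End.mul_apply, hv, map_smul, ih, smul_smul, pow_succ']

/-- `f ^ m` preserves the eigenspaces of `f`. [folklore] -/
theorem mapsTo_pow_eigenspace (f : End K V) (μ : K) (m : ℕ) :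
    Set.MapsTo ⇑(f ^ m) (f.eigenspace μ) (f.eigenspace μ) := by
  intro v hv
  have hv' := hv
  rw [SetLike.mem_coe, mem_eigenspace_iff] at hv ⊢
  rw [pow_apply_of_mem_eigenspace f μ m hv', map_smul, hv, smul_comm]

/-- An endomorphism of finite order `N`, `N ≠ 0` in `K`, is semisimple: it is killed by the
separable polynomial `X ^ N - 1`.
Ref: Bourbaki, *Algèbre*, Ch. VII §5 (an endomorphism with a squarefree, separable annihilating
polynomial is semisimple). [folklore] -/
theorem isSemisimple_of_pow_eq_one {f : End K V} {N : ℕ} (hN : (N : K) ≠ 0) (hfN : f ^ N = 1) :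
    f.IsSemisimple := by
  refine isSemisimple_of_squarefree_aeval_eq_zero
    (separable_X_pow_sub_C (1 : K) hN one_ne_zero).squarefree ?_
  simp [hfN]

variable [IsAlgClosed K] [FiniteDimensional K V]

/-- **Traces of powers of a semisimple endomorphism from its characteristic polynomial.** For a
semisimple endomorphism `f` of a finite-dimensional vector space over an algebraically closed
field and every `m`, `tr(f ^ m) = Σ_μ mult_μ(χ_f) · μ ^ m`, the sum over the (distinct) roots
`μ` of the characteristic polynomial `χ_f` weighted by their multiplicities: `V = ⊕_μ V_μ` is the
direct sum of the eigenspaces, `f ^ m` acts on `V_μ` as `μ ^ m`, and `dim V_μ = mult_μ(χ_f)`.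
Ref: Bourbaki, *Algèbre*, Ch. VII §5 (diagonalisable endomorphisms); Curtis–Reiner (1962), §30.
[folklore] -/
theorem trace_pow_eq_sum_rootMultiplicity [DecidableEq K] (f : End K V) (hf : f.IsSemisimple)
    (m : ℕ) :
    LinearMap.trace K V (f ^ m) =
      ∑ μ ∈ f.charpoly.roots.toFinset, (f.charpoly.rootMultiplicity μ : K) * μ ^ m := by
  -- `V` is the direct sum of the eigenspaces, finitely many of which are non-zero
  have hint : DirectSum.IsInternal f.eigenspace :=
    DirectSum.isInternal_submodule_of_iSupIndep_of_iSup_eq_top f.eigenspaces_iSupIndep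
      hf.iSup_eigenspace_eq_top
  have hne : f.charpoly ≠ 0 := f.charpoly_monic.ne_zero
  have hsupp : {μ : K | f.eigenspace μ ≠ ⊥} = (f.charpoly.roots.toFinset : Set K) := by
    ext μ
    rw [Set.mem_setOf_eq, Finset.mem_coe, Multiset.mem_toFinset, mem_roots hne,
      ← hasEigenvalue_iff, hasEigenvalue_iff_isRoot_charpoly]
  have hfin : {μ : K | f.eigenspace μ ≠ ⊥}.Finite := by
    rw [hsupp]; exact Finset.finite_toSet _
  rw [LinearMap.trace_eq_sum_trace_restrict' hint hfin (mapsTo_pow_eigenspace f · m)]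
  have hset : hfin.toFinset = f.charpoly.roots.toFinset := by
    rw [← Finset.coe_inj, Set.Finite.coe_toFinset, hsupp]
  rw [hset]
  refine Finset.sum_congr rfl fun μ _ ↦ ?_
  -- on `V_μ`, `f ^ m = μ ^ m • id` has trace `μ ^ m · dim V_μ = μ ^ m · mult_μ(χ_f)`
  have hres : (f ^ m).restrict (mapsTo_pow_eigenspace f μ m) =
      μ ^ m • (LinearMap.id : f.eigenspace μ →ₗ[K] f.eigenspace μ) := by
    ext ⟨v, hv⟩
    simp [LinearMap.restrict_apply, pow_apply_of_mem_eigenspace f μ m hv]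
  rw [hres, map_smul, LinearMap.trace_id, smul_eq_mul, mul_comm]
  congr 1
  rw [← LinearMap.finrank_maxGenEigenspace_eq,
    hf.isFinitelySemisimple.maxGenEigenspace_eq_eigenspace]

/-- **Traces of powers of finite-order endomorphisms are determined by the characteristic
polynomial.** If `f ^ N = 1 = g ^ N` with `N ≠ 0` in `K` and `χ_f = χ_g`, then
`tr(f ^ m) = tr(g ^ m)` for every `m`.
Ref: Curtis–Reiner (1962), §30 (characteristic roots of elements of finite order). [folklore] -/
theorem trace_pow_eq_of_charpoly_eq {f g : End K V} {N : ℕ} (hN : (N : K) ≠ 0) (hfN : f ^ N = 1)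
    (hgN : g ^ N = 1) (h : f.charpoly = g.charpoly) (m : ℕ) :
    LinearMap.trace K V (f ^ m) = LinearMap.trace K V (g ^ m) := by
  classical
  rw [trace_pow_eq_sum_rootMultiplicity f (isSemisimple_of_pow_eq_one hN hfN),
    trace_pow_eq_sum_rootMultiplicity g (isSemisimple_of_pow_eq_one hN hgN), h]

/-- **Matrix form.** If `M ^ N = 1 = M' ^ N` with `N ≠ 0` in `K` and `χ_M = χ_{M'}` for square
matrices over an algebraically closed field, then `tr(M ^ m) = tr(M' ^ m)` for every `m`
(`trace_pow_eq_of_charpoly_eq` transported along Mathlib's `Matrix.toLin'`,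
`Matrix.charpoly_toLin'`, `Matrix.trace_toLin'_eq`).
Ref: Curtis–Reiner (1962), §30. [folklore] -/
theorem matrix_trace_pow_eq_of_charpoly_eq {n : Type*} [Fintype n] [DecidableEq n]
    {M M' : Matrix n n K} {N : ℕ} (hN : (N : K) ≠ 0) (hM : M ^ N = 1) (hM' : M' ^ N = 1)
    (h : M.charpoly = M'.charpoly) (m : ℕ) : (M ^ m).trace = (M' ^ m).trace := by
  have h1 := trace_pow_eq_of_charpoly_eq (f := Matrix.toLin' M) (g := Matrix.toLin' M') hN
    (by rw [← Matrix.toLin'_pow, hM, Matrix.toLin'_one]; rfl)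
    (by rw [← Matrix.toLin'_pow, hM', Matrix.toLin'_one]; rfl)
    (by rw [Matrix.charpoly_toLin', Matrix.charpoly_toLin', h]) m
  rwa [← Matrix.toLin'_pow, ← Matrix.toLin'_pow, Matrix.trace_toLin'_eq,
    Matrix.trace_toLin'_eq] at h1

end TracePow

end Literature.RepresentationTheory.FiniteGroups
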